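import Summits.NavierStokesRegularity.NavierStokesRegularity.Theorems.FilamentSkeletonRssKelvinGateSmoothingPressure
import HarnessLib

/-!
# Route `FilamentSkeletonRss` · crux `TransverseReductionRJ` (stmt-NavierStokesRegularity-21221), line
# `kelvin_gate`, stub S4 `EllipticSmoothing` — helper III: the `H^s_loc` ladder for the rotated, forced
# Leray profile system (`U, P ∈ C^∞`)

HONEST FRAMING. Bookkeeping for a HYPOTHETICAL filament-type RSS blow-up route; nothing here bears
on Navier–Stokes regularity; no stub is proved in this file. For `U ∈ C²(ℝ³; ℝ³)` divergence free,
`P ∈ C¹`, `F ∈ C^∞` solving `α(e₃ × U − DU[e₃ × y]) + ½U + ½DU[y] − ΔU + DU[U] + ∇P = F`: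
`locallyHs_velocity_pressure` (`Uᵢ ∈ H^{k+2}_loc`, `P ∈ H^{k+1}_loc` for all `k` — the Sobolev
bootstrap of the tree's `IsLerayProfile.locallyHs_velocity_pressure` run with the extra rotation
pair and forcing, the weak pressure equation being `…SmoothingPressure.integral_pressure_mul_laplacian`),
`contDiff_velocity_infty` (`U ∈ C^∞`), `contDiff_pressure_infty` (`P ∈ C^∞`).
References: T.-P. Tsai, ARMA 143 (1998), p. 33; G. B. Folland, *Introduction to PDE* (1995),
§6.A (6.5), §6.C (6.33).
-/

set_option linter.dupNamespace false

noncomputable section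

namespace Summit.NavierStokesRegularity.NavierStokesRegularity.Theorems.KelvinGate.Smoothing

open MeasureTheory Set Function
open Literature.Analysis.FluidPDE Literature.Analysis.FunctionSpaces
open scoped ENNReal ContDiff RealInnerProductSpace

/-! ### The components of `e₃ × w` -/

/-- `(e₃ × w)₀ = −w₁`. [folklore] -/
theorem cross_e3_apply_zero (w : EuclideanSpace ℝ (Fin 3)) :
    (cross (EuclideanSpace.single 2 1) w) 0 = -w 1 := by
  simp [cross, crossProduct]

/-- `(e₃ × w)₁ = w₀`. [folklore] -/
theorem cross_e3_apply_one (w : EuclideanSpace ℝ (Fin 3)) :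
    (cross (EuclideanSpace.single 2 1) w) 1 = w 0 := by
  simp [cross, crossProduct]

/-- `(e₃ × w)₂ = 0`. [folklore] -/
theorem cross_e3_apply_two (w : EuclideanSpace ℝ (Fin 3)) :
    (cross (EuclideanSpace.single 2 1) w) 2 = 0 := by
  simp [cross, crossProduct]

/-! ### The ladder -/

section System

variable {U F : EuclideanSpace ℝ (Fin 3) → EuclideanSpace ℝ (Fin 3)} {P : EuclideanSpace ℝ (Fin 3) → ℝ}
  {α : ℝ}

/-- **The Sobolev bootstrap for the rotated forced profile system**: for every `k : ℕ` the
complexified velocity components are in `H^{k+2}_loc` and the pressure in `H^{k+1}_loc`.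
[cite: Tsai1998, p. 33] -/
theorem locallyHs_velocity_pressure (hU : ContDiff ℝ 2 U) (hdiv : VectorCalculus.IsDivFree U)
    (hP : ContDiff ℝ 1 P) (hF : ContDiff ℝ ∞ F)
    (heq : ∀ y, α • (cross (EuclideanSpace.single 2 1) (U y) -
        fderiv ℝ U y (cross (EuclideanSpace.single 2 1) y)) + (1 / 2 : ℝ) • U y +
        (1 / 2 : ℝ) • fderiv ℝ U y y - (Laplacian.laplacian U) y + fderiv ℝ U y (U y) +
        gradient P y = F y) (k : ℕ) :
    (∀ i, LocallyHs ((k : ℝ) + 2) (fun x => (U x i : ℂ))) ∧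
      LocallyHs ((k : ℝ) + 1) (fun x => (P x : ℂ)) := by
  set b := EuclideanSpace.basisFun (Fin 3) ℝ with hbdef
  have hd : (Module.finrank ℝ (EuclideanSpace ℝ (Fin 3)) : ℝ) ≤ 3 := by
    rw [finrank_euclideanSpace]; norm_num
  -- regularity bookkeeping
  have hUc : ∀ i, ContDiff ℝ 2 (fun z => U z i) := fun i => contDiff_comp_euclidean hU i
  have hU1 : ∀ i, ContDiff ℝ 1 (fun z => U z i) := fun i => (hUc i).of_le (by norm_num)
  have hUd : ∀ i, Differentiable ℝ (fun z => U z i) := fun i => (hU1 i).differentiable one_ne_zero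
  have hd1 : ∀ i j, ContDiff ℝ 1 (pderiv j fun z => U z i) := fun i j =>
    contDiff_one_pderiv_of_contDiff_two (hUc i) j
  have hdd : ∀ i j, Differentiable ℝ (pderiv j fun z => U z i) := fun i j =>
    (hd1 i j).differentiable one_ne_zero
  have hPd : Differentiable ℝ P := hP.differentiable one_ne_zero
  have hFc : ∀ i, ContDiff ℝ ∞ (fun z => F z i) := fun i => contDiff_comp_euclidean hF i
  have hF1 : ContDiff ℝ 1 F := hF.of_le (by exact_mod_cast le_top)
  -- complexified objects
  set Uc : Fin 3 → EuclideanSpace ℝ (Fin 3) → ℂ := fun i x => (U x i : ℂ) with hUcdef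
  set Pc : EuclideanSpace ℝ (Fin 3) → ℂ := fun x => (P x : ℂ) with hPcdef
  set dU : Fin 3 → Fin 3 → EuclideanSpace ℝ (Fin 3) → ℂ :=
    fun i j x => (pderiv j (fun z => U z i) x : ℂ) with hdUdef
  set dP : Fin 3 → EuclideanSpace ℝ (Fin 3) → ℂ := fun i x => (pderiv i P x : ℂ) with hdPdef
  set N₁ : Fin 3 → EuclideanSpace ℝ (Fin 3) → ℂ := fun i x => ∑ j, Uc j x * dU i j x with hN₁def
  set N₂ : Fin 3 → EuclideanSpace ℝ (Fin 3) → ℂ :=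
    fun i x => ∑ j, ((x j : ℝ) : ℂ) * dU i j x with hN₂def
  set Rc : Fin 3 → EuclideanSpace ℝ (Fin 3) → ℂ :=
    fun j x => (((cross (EuclideanSpace.single 2 1) x) j : ℝ) : ℂ) with hRcdef
  set N₃ : Fin 3 → EuclideanSpace ℝ (Fin 3) → ℂ := fun i x => ∑ j, Rc j x * dU i j x with hN₃def
  set Ro : Fin 3 → EuclideanSpace ℝ (Fin 3) → ℂ :=
    fun i x => (((cross (EuclideanSpace.single 2 1) (U x)) i : ℝ) : ℂ) with hRodef
  set Fo : Fin 3 → EuclideanSpace ℝ (Fin 3) → ℂ := fun i x => ((F x i : ℝ) : ℂ) with hFodef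
  set q : EuclideanSpace ℝ (Fin 3) → ℂ := fun x =>
    ((∑ i, pderiv i (fun z => F z i) x -
      ∑ i, ∑ j, pderiv i (fun z => U z j) x * pderiv j (fun z => U z i) x : ℝ) : ℂ) with hqdef
  set L : Fin 3 → EuclideanSpace ℝ (Fin 3) → ℂ := fun i x =>
    ∑ j, fderiv ℝ (fun y => fderiv ℝ (Uc i) y (b j)) x (b j) with hLdef
  have hUc2 : ∀ i, ContDiff ℝ 2 (Uc i) := fun i => contDiff_ofReal_comp (hUc i)
  have hUc1 : ∀ i, ContDiff ℝ 1 (Uc i) := fun i => contDiff_ofReal_comp (hU1 i)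
  have hPc1 : ContDiff ℝ 1 Pc := contDiff_ofReal_comp hP
  have hdU1 : ∀ i j, ContDiff ℝ 1 (dU i j) := fun i j => contDiff_ofReal_comp (hd1 i j)
  have hdPc : ∀ i, Continuous (dP i) := fun i =>
    Complex.continuous_ofReal.comp (continuous_pderiv hP one_ne_zero i)
  have hcoordc : ∀ j, ContDiff ℝ ∞ (fun x : EuclideanSpace ℝ (Fin 3) => ((x j : ℝ) : ℂ)) := fun j =>
    contDiff_ofReal_comp (contDiff_euclideanCoord j)
  have hRcs : ∀ j, ContDiff ℝ ∞ (Rc j) := by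
    intro j
    have h : ContDiff ℝ ∞ (fun y : EuclideanSpace ℝ (Fin 3) => crossCLM (EuclideanSpace.single 2 1) y) :=
      (crossCLM (EuclideanSpace.single 2 1)).contDiff
    exact contDiff_ofReal_comp (contDiff_comp_euclidean h j)
  have hFos : ∀ i, ContDiff ℝ ∞ (Fo i) := fun i => contDiff_ofReal_comp (hFc i)
  have hN₁1 : ∀ i, ContDiff ℝ 1 (N₁ i) := fun i =>
    ContDiff.sum fun j _ => (hUc1 j).mul (hdU1 i j)
  have hN₂1 : ∀ i, ContDiff ℝ 1 (N₂ i) := fun i =>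
    ContDiff.sum fun j _ => ((hcoordc j).of_le (by exact_mod_cast le_top)).mul (hdU1 i j)
  have hN₃1 : ∀ i, ContDiff ℝ 1 (N₃ i) := fun i =>
    ContDiff.sum fun j _ => ((hRcs j).of_le (by exact_mod_cast le_top)).mul (hdU1 i j)
  -- the rotation field `(e₃ × U)ᵢ` is `0`, `U₀` or `-U₁`
  have hRo_eq : ∀ i, Ro i = fun x => (if i = 0 then -Uc 1 x else if i = 1 then Uc 0 x else 0) := by
    intro i
    funext x
    fin_cases i
    · simp [hRodef, hUcdef, cross_e3_apply_zero]
    · simp [hRodef, hUcdef, cross_e3_apply_one]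
    · simp [hRodef, cross_e3_apply_two]
  have hRo1 : ∀ i, ContDiff ℝ 1 (Ro i) := by
    intro i
    rw [hRo_eq i]
    fin_cases i
    · simpa using (hUc1 1).neg
    · simpa using hUc1 0
    · simpa using (contDiff_const : ContDiff ℝ 1 fun _ : EuclideanSpace ℝ (Fin 3) => (0 : ℂ))
  have hRoHs : ∀ (s : ℝ) (i : Fin 3), (∀ l, LocallyHs s (Uc l)) → LocallyHs s (Ro i) := by
    intro s i H
    rw [hRo_eq i]
    fin_cases i
    · simpa using (H 1).neg (hUc1 1).continuous
    · simpa using H 0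
    · simpa using locallyHs_of_contDiff_infty
        (contDiff_const : ContDiff ℝ ∞ fun _ : EuclideanSpace ℝ (Fin 3) => (0 : ℂ)) s
  have hq1 : ContDiff ℝ 1 q := by
    have hqeq : q = fun x => (∑ i, ((pderiv i (fun z => F z i) x : ℝ) : ℂ)) -
        ∑ i, ∑ j, dU j i x * dU i j x := by
      funext x; simp only [hqdef, hdUdef]; push_cast; ring
    rw [hqeq]
    refine (ContDiff.sum fun i _ => contDiff_ofReal_comp ((contDiff_pderiv (hFc i) i).of_le
      (by exact_mod_cast le_top))).sub ?_
    exact ContDiff.sum fun i _ => ContDiff.sum fun j _ => (hdU1 j i).mul (hdU1 i j)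
  -- coordinate identities
  have hfdU : ∀ i j, (fun x => fderiv ℝ (Uc i) x (b j)) = dU i j := by
    intro i j
    have := fderiv_ofReal_comp_stdVec (hUd i) j
    simpa only [hbdef] using this
  have hfdP : ∀ i, (fun x => fderiv ℝ Pc x (b i)) = dP i := by
    intro i
    have := fderiv_ofReal_comp_stdVec hPd i
    simpa only [hbdef] using this
  have hLeq' : ∀ i x, L i x = ((∑ j, pderiv j (pderiv j fun z => U z i) x : ℝ) : ℂ) := by
    intro i x
    simp only [hLdef]
    push_cast
    refine Finset.sum_congr rfl fun j _ => ?_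
    have h1 : (fun y => fderiv ℝ (Uc i) y (b j)) = fun y => ((pderiv j (fun z => U z i) y : ℝ) : ℂ) :=
      hfdU i j
    rw [h1]
    have := congrFun (fderiv_ofReal_comp_stdVec (hdd i j) j) x
    simpa only [hbdef] using this
  have hLc' : ∀ i, Continuous (L i) := by
    intro i
    have e : L i = fun x => ((∑ j, pderiv j (pderiv j fun z => U z i) x : ℝ) : ℂ) :=
      funext (hLeq' i)
    rw [e]
    exact Complex.continuous_ofReal.comp (continuous_finsetSum _ fun j _ =>
      continuous_pderiv (hd1 i j) one_ne_zero j)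
  -- the profile equation: `L_i = ∂_i P + ½ U_i + ½ N₂ + N₁ + α (Ro - N₃) - F_i`
  have hLeq : ∀ i, L i = fun x => dP i x + ((1 / 2 : ℂ) * Uc i x + (1 / 2 : ℂ) * N₂ i x + N₁ i x +
      (α : ℂ) * (Ro i x - N₃ i x) - Fo i x) := by
    intro i
    funext x
    rw [hLeq' i x]
    have hpc := pderiv_pressure_eq hU heq i x
    have e : ∑ j, pderiv j (pderiv j fun z => U z i) x =
        pderiv i P x + ((1 / 2 : ℝ) * U x i + (1 / 2 : ℝ) * ∑ j, x j * pderiv j (fun z => U z i) x +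
          ∑ j, U x j * pderiv j (fun z => U z i) x +
          α * ((cross (EuclideanSpace.single 2 1) (U x)) i -
            ∑ j, (cross (EuclideanSpace.single 2 1) x) j * pderiv j (fun z => U z i) x) - F x i) := by
      linarith
    rw [e]
    simp only [hdPdef, hUcdef, hN₂def, hN₁def, hdUdef, hRodef, hN₃def, hRcdef, hFodef]
    push_cast
    ring
  -- the weak equations
  have hPq : ∀ ψ : EuclideanSpace ℝ (Fin 3) → ℂ, ContDiff ℝ ∞ ψ → HasCompactSupport ψ →
      ∫ x, Pc x * ∑ i, fderiv ℝ (fun y => fderiv ℝ ψ y (b i)) x (b i) = ∫ x, q x * ψ x :=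
    fun ψ hψ hψs => integral_pressure_mul_laplacian hU hdiv hP hF1 heq ψ hψ hψs
  have hUL : ∀ i, ∀ ψ : EuclideanSpace ℝ (Fin 3) → ℂ, ContDiff ℝ ∞ ψ → HasCompactSupport ψ →
      ∫ x, Uc i x * ∑ j, fderiv ℝ (fun y => fderiv ℝ ψ y (b j)) x (b j) = ∫ x, L i x * ψ x :=
    fun i ψ hψ hψs => integral_mul_sum_fderiv_fderiv b (hUc2 i) ψ hψ hψs
  -- products one level up, with the `k = 0` case done classically
  have hprod : ∀ (k : ℕ) {f g : EuclideanSpace ℝ (Fin 3) → ℂ}, ContDiff ℝ 1 f → ContDiff ℝ 1 g →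
      LocallyHs ((k : ℝ) + 1) f → LocallyHs ((k : ℝ) + 1) g →
      LocallyHs ((k : ℝ) + 1) (fun x => f x * g x) := by
    intro k f g hf hg hfl hgl
    rcases Nat.eq_zero_or_pos k with hk | hk
    · subst hk
      have := locallyHs_of_contDiff (hf.mul hg)
      simpa using this
    · refine hfl.mul ?_ hf.continuous hg.continuous hgl
      have : (1 : ℝ) ≤ k := by exact_mod_cast hk
      linarith
  -- the induction
  induction k with
  | zero =>
    refine ⟨fun i => ?_, ?_⟩
    · have := locallyHs_of_contDiff (hUc2 i)
      norm_num
      exact_mod_cast this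
    · have := locallyHs_of_contDiff hPc1
      norm_num
      exact_mod_cast this
  | succ k ih =>
    obtain ⟨HU, HP⟩ := ih
    -- (a) first derivatives of `U`
    have HdU : ∀ i j, LocallyHs ((k : ℝ) + 1) (dU i j) := fun i j => by
      have := (HU i).fderiv_apply (hUc1 i) (b j)
      rw [hfdU i j] at this
      have e : (k : ℝ) + 2 - 1 = k + 1 := by ring
      rwa [e] at this
    -- (b) the quadratic and drift terms and the source
    have Hq : LocallyHs ((k : ℝ) + 1) q := by
      have hqeq : q = fun x => (∑ i, ((pderiv i (fun z => F z i) x : ℝ) : ℂ)) -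
          ∑ i, ∑ j, dU j i x * dU i j x := by
        funext x; simp only [hqdef, hdUdef]; push_cast; ring
      rw [hqeq]
      have hA : ContDiff ℝ ∞ (fun x => ∑ i, ((pderiv i (fun z => F z i) x : ℝ) : ℂ)) :=
        ContDiff.sum fun i _ => contDiff_ofReal_comp (contDiff_pderiv (hFc i) i)
      refine (locallyHs_of_contDiff_infty hA _).sub hA.continuous
        (continuous_finsetSum _ fun i _ => continuous_finsetSum _ fun j _ =>
          ((hdU1 j i).mul (hdU1 i j)).continuous) ?_
      refine LocallyHs.finset_sum _ (fun i => continuous_finsetSum _ fun j _ =>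
        ((hdU1 j i).mul (hdU1 i j)).continuous) fun i => ?_
      exact LocallyHs.finset_sum _ (fun j => ((hdU1 j i).mul (hdU1 i j)).continuous) fun j =>
        hprod k (hdU1 j i) (hdU1 i j) (HdU j i) (HdU i j)
    have HN₁ : ∀ i, LocallyHs ((k : ℝ) + 1) (N₁ i) := fun i =>
      LocallyHs.finset_sum _ (fun j => ((hUc1 j).mul (hdU1 i j)).continuous) fun j =>
        hprod k (hUc1 j) (hdU1 i j) ((HU j).mono (by linarith)) (HdU i j)
    have HN₂ : ∀ i, LocallyHs ((k : ℝ) + 1) (N₂ i) := fun i =>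
      LocallyHs.finset_sum _ (fun j => (((hcoordc j).of_le (by exact_mod_cast le_top)).mul
        (hdU1 i j)).continuous) fun j =>
        hprod k ((hcoordc j).of_le (by exact_mod_cast le_top)) (hdU1 i j)
          (locallyHs_of_contDiff_infty (hcoordc j) _) (HdU i j)
    have HN₃ : ∀ i, LocallyHs ((k : ℝ) + 1) (N₃ i) := fun i =>
      LocallyHs.finset_sum _ (fun j => (((hRcs j).of_le (by exact_mod_cast le_top)).mul
        (hdU1 i j)).continuous) fun j =>
        hprod k ((hRcs j).of_le (by exact_mod_cast le_top)) (hdU1 i j)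
          (locallyHs_of_contDiff_infty (hRcs j) _) (HdU i j)
    have HRo : ∀ i, LocallyHs ((k : ℝ) + 1) (Ro i) := fun i =>
      (hRoHs _ i HU).mono (by linarith)
    have HFo : ∀ i, LocallyHs ((k : ℝ) + 1) (Fo i) := fun i => locallyHs_of_contDiff_infty (hFos i) _
    -- (c) the pressure, twice
    have HP2 : LocallyHs ((k : ℝ) + 2) Pc := by
      refine LocallyHs.of_weakLaplacian b hPc1 hq1.continuous hPq ?_ ?_
      · have e : (k : ℝ) + 2 - 1 = k + 1 := by ring
        rw [e]; exact HP
      · have e : (k : ℝ) + 2 - 2 = k := by ring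
        rw [e]; exact Hq.mono (by linarith)
    have HP3 : LocallyHs ((k : ℝ) + 3) Pc := by
      refine LocallyHs.of_weakLaplacian b hPc1 hq1.continuous hPq ?_ ?_
      · have e : (k : ℝ) + 3 - 1 = k + 2 := by ring
        rw [e]; exact HP2
      · have e : (k : ℝ) + 3 - 2 = k + 1 := by ring
        rw [e]; exact Hq
    -- (d) the pressure gradient
    have HdP : ∀ i, LocallyHs ((k : ℝ) + 2) (dP i) := fun i => by
      have := HP3.fderiv_apply hPc1 (b i)
      rw [hfdP i] at this
      have e : (k : ℝ) + 3 - 1 = k + 2 := by ring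
      rwa [e] at this
    -- (e) the Laplacian of `U`
    have HM : ∀ i, LocallyHs ((k : ℝ) + 1) (fun x => (1 / 2 : ℂ) * Uc i x + (1 / 2 : ℂ) * N₂ i x +
        N₁ i x + (α : ℂ) * (Ro i x - N₃ i x) - Fo i x) := by
      intro i
      have c1 : Continuous fun x => (1 / 2 : ℂ) * Uc i x := continuous_const.mul (hUc1 i).continuous
      have c2 : Continuous fun x => (1 / 2 : ℂ) * N₂ i x := continuous_const.mul (hN₂1 i).continuous
      have c3 : Continuous (N₁ i) := (hN₁1 i).continuous
      have c4 : Continuous fun x => Ro i x - N₃ i x := (hRo1 i).continuous.sub (hN₃1 i).continuous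
      have c5 : Continuous fun x => (α : ℂ) * (Ro i x - N₃ i x) := continuous_const.mul c4
      have c6 : Continuous (Fo i) := (hFos i).continuous
      have l1 : LocallyHs ((k : ℝ) + 1) fun x => (1 / 2 : ℂ) * Uc i x :=
        ((HU i).mono (by linarith)).const_mul (hUc1 i).continuous _
      have l2 : LocallyHs ((k : ℝ) + 1) fun x => (1 / 2 : ℂ) * N₂ i x :=
        (HN₂ i).const_mul (hN₂1 i).continuous _
      have l4 : LocallyHs ((k : ℝ) + 1) fun x => Ro i x - N₃ i x :=
        (HRo i).sub (hRo1 i).continuous (hN₃1 i).continuous (HN₃ i)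
      have l5 : LocallyHs ((k : ℝ) + 1) fun x => (α : ℂ) * (Ro i x - N₃ i x) := l4.const_mul c4 _
      exact ((((l1.add c1 c2 l2).add (c1.add c2) c3 (HN₁ i)).add ((c1.add c2).add c3) c5 l5).sub
        (((c1.add c2).add c3).add c5) c6 (HFo i))
    have HL : ∀ i, LocallyHs ((k : ℝ) + 1) (L i) := fun i => by
      rw [hLeq i]
      have cM : Continuous fun x => (1 / 2 : ℂ) * Uc i x + (1 / 2 : ℂ) * N₂ i x +
          N₁ i x + (α : ℂ) * (Ro i x - N₃ i x) - Fo i x :=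
        ((((continuous_const.mul (hUc1 i).continuous).add (continuous_const.mul (hN₂1 i).continuous)).add
          (hN₁1 i).continuous).add (continuous_const.mul ((hRo1 i).continuous.sub
          (hN₃1 i).continuous))).sub (hFos i).continuous
      exact ((HdP i).mono (by linarith)).add (hdPc i) cM (HM i)
    -- (f) the velocity
    have HU3 : ∀ i, LocallyHs ((k : ℝ) + 3) (Uc i) := fun i => by
      refine LocallyHs.of_weakLaplacian b (hUc1 i) (hLc' i) (hUL i) ?_ ?_
      · have e : (k : ℝ) + 3 - 1 = k + 2 := by ring
        rw [e]; exact HU i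
      · have e : (k : ℝ) + 3 - 2 = k + 1 := by ring
        rw [e]; exact HL i
    refine ⟨fun i => ?_, ?_⟩
    · have e : ((k + 1 : ℕ) : ℝ) + 2 = k + 3 := by push_cast; ring
      rw [e]; exact HU3 i
    · have e : ((k + 1 : ℕ) : ℝ) + 1 = k + 2 := by push_cast; ring
      rw [e]; exact HP2

/-- **The velocity of the rotated forced profile system is smooth** (`U ∈ C^∞`, from
`Uᵢ ∈ H^{k+2}_loc` for all `k` and the local Sobolev lemma). [cite: Tsai1998, p. 33] -/
theorem contDiff_velocity_infty (hU : ContDiff ℝ 2 U) (hdiv : VectorCalculus.IsDivFree U)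
    (hP : ContDiff ℝ 1 P) (hF : ContDiff ℝ ∞ F)
    (heq : ∀ y, α • (cross (EuclideanSpace.single 2 1) (U y) -
        fderiv ℝ U y (cross (EuclideanSpace.single 2 1) y)) + (1 / 2 : ℝ) • U y +
        (1 / 2 : ℝ) • fderiv ℝ U y y - (Laplacian.laplacian U) y + fderiv ℝ U y (U y) +
        gradient P y = F y) : ContDiff ℝ ∞ U := by
  rw [contDiff_infty]
  intro n
  rw [contDiff_euclidean]
  intro i
  have HU := (locallyHs_velocity_pressure hU hdiv hP hF heq n).1 i
  have hd : (Module.finrank ℝ (EuclideanSpace ℝ (Fin 3)) : ℝ) < 2 * (((n : ℝ) + 2) - n) := by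
    rw [finrank_euclideanSpace]; norm_num
  have hc : ContDiff ℝ n (fun x => (U x i : ℂ)) :=
    HU.contDiff hd (Complex.continuous_ofReal.comp (contDiff_comp_euclidean hU i |>.continuous))
  have e : (fun x => U x i) = fun x => Complex.re ((U x i : ℂ)) := by
    funext x; simp
  rw [e]
  exact Complex.reCLM.contDiff.comp hc

/-- **The pressure of the rotated forced profile system is smooth** (its gradient
`∂ᵢP = Σⱼ∂ⱼ∂ⱼUᵢ + Gᵢ` is smooth once `U` is). [cite: Tsai1998, p. 34] -/
theorem contDiff_pressure_infty (hU : ContDiff ℝ 2 U) (hdiv : VectorCalculus.IsDivFree U)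
    (hP : ContDiff ℝ 1 P) (hF : ContDiff ℝ ∞ F)
    (heq : ∀ y, α • (cross (EuclideanSpace.single 2 1) (U y) -
        fderiv ℝ U y (cross (EuclideanSpace.single 2 1) y)) + (1 / 2 : ℝ) • U y +
        (1 / 2 : ℝ) • fderiv ℝ U y y - (Laplacian.laplacian U) y + fderiv ℝ U y (U y) +
        gradient P y = F y) : ContDiff ℝ ∞ P := by
  have hUs : ContDiff ℝ ∞ U := contDiff_velocity_infty hU hdiv hP hF heq
  have hUc : ∀ i, ContDiff ℝ ∞ (fun z : EuclideanSpace ℝ (Fin 3) => U z i) := fun i =>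
    contDiff_comp_euclidean hUs i
  have hFc : ∀ i, ContDiff ℝ ∞ (fun z : EuclideanSpace ℝ (Fin 3) => F z i) := fun i =>
    contDiff_comp_euclidean hF i
  have hPd : Differentiable ℝ P := hP.differentiable one_ne_zero
  have hcU : ∀ i, ContDiff ℝ ∞ (fun y => (cross (EuclideanSpace.single 2 1) (U y)) i) := by
    intro i
    have h : ContDiff ℝ ∞ (fun y => crossCLM (EuclideanSpace.single 2 1) (U y)) :=
      (crossCLM (EuclideanSpace.single 2 1)).contDiff.comp hUs
    exact contDiff_comp_euclidean h i
  have hcy : ∀ j, ContDiff ℝ ∞ (fun y : EuclideanSpace ℝ (Fin 3) => (cross (EuclideanSpace.single 2 1) y) j) := by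
    intro j
    have h : ContDiff ℝ ∞ (fun y : EuclideanSpace ℝ (Fin 3) => crossCLM (EuclideanSpace.single 2 1) y) :=
      (crossCLM (EuclideanSpace.single 2 1)).contDiff
    exact contDiff_comp_euclidean h j
  have hpi : ∀ i, ContDiff ℝ ∞ (pderiv i P) := by
    intro i
    have e : pderiv i P = fun y => (∑ j, pderiv j (pderiv j fun z => U z i) y) +
        (F y i - (1 / 2 : ℝ) * U y i - (1 / 2 : ℝ) * ∑ j, y j * pderiv j (fun z => U z i) y -
          ∑ j, U y j * pderiv j (fun z => U z i) y -
          α * ((cross (EuclideanSpace.single 2 1) (U y)) i -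
            ∑ j, (cross (EuclideanSpace.single 2 1) y) j * pderiv j (fun z => U z i) y)) :=
      funext fun y => pderiv_pressure_eq hU heq i y
    rw [e]
    refine (ContDiff.sum fun j _ => contDiff_pderiv (contDiff_pderiv (hUc i) j) j).add ?_
    refine ((((hFc i).sub (contDiff_const.mul (hUc i))).sub (contDiff_const.mul
      (ContDiff.sum fun j _ => (contDiff_euclideanCoord j).mul (contDiff_pderiv (hUc i) j)))).sub
      (ContDiff.sum fun j _ => (hUc j).mul (contDiff_pderiv (hUc i) j))).sub
      (contDiff_const.mul ((hcU i).sub (ContDiff.sum fun j _ => (hcy j).mul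
        (contDiff_pderiv (hUc i) j))))
  have hf : fderiv ℝ P = fun y => ∑ i, pderiv i P y •
      (EuclideanSpace.proj i : EuclideanSpace ℝ (Fin 3) →L[ℝ] ℝ) := by
    funext y
    ext w
    rw [fderiv_apply_eq_sum_mul_pderiv, _root_.sum_apply]
    refine Finset.sum_congr rfl fun i _ => ?_
    rw [_root_.smul_apply, smul_eq_mul, mul_comm]
    rfl
  rw [contDiff_infty_iff_fderiv, hf]
  exact ⟨hPd, ContDiff.sum fun i _ => (hpi i).smul contDiff_const⟩

end System

end Summit.NavierStokesRegularity.NavierStokesRegularity.Theorems.KelvinGate.Smoothing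

end
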